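import Summits.BirchSwinnertonDyer.Rank1Residual.Additive.GoodModelFormalH1AlmostEtale
import Summits.BirchSwinnertonDyer.Rank1Residual.Additive.GoodModelKernelH1Transport
import Summits.BirchSwinnertonDyer.Rank1Residual.Additive.GoodModelKernelH1Layer
import Literature.NumberTheory.EllipticCurves.CoatesGreenberg1996.DeeplyRamifiedTrace
import HarnessLib

/-!
# The Coates–Greenberg record `H1_goodModelKernel_trivial` (A254: `H¹(L, Ŵ₀(𝔪̄)) = 0` for a good
# model, [CoGr] Cor. 3.2 in cocycle form) DERIVED from the trace form of "deeply ramified"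
# (`CoatesGreenberg1996.deeplyRamified_cyclotomic_trace`) by the almost-étale successive
# approximation

HONEST FRAMING (BSD rank-`≤ 1` residual cell `b2b-bsdres`, home
`run/shared/lean/b2b/bsd-rank1-residual/`, team n1011, seat n1011-p05 GEN 9, row T-CG-DR, skeleton
`cells/n1011/skel/T-CG-DR.md`, lead R5-83 (e), referee-1 GEN 32 ACK-1): the cell deletes the
COMBINATION-SHAPED residual classes of the rank-`≤ 1` BSD formula from PUBLISHED theorems only and
TYPES the construction-shaped ones; research route, no claim beyond the stated classes, census
output = EVIDENCE, nothing booked, no mark moves. END file (theorems only, no definition, no named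
fact): `CoatesGreenberg1996.H1_goodModelKernel_trivial_of_deeplyRamifiedTrace : DR → R` with R's
signature UNCHANGED — registry A254 becomes DERIVED modulo the field-theoretic fact DR; NOT a
discharge of Tate–Sen / [CoGr] §2. Consumers may switch `hCG ↦ …_of_deeplyRamifiedTrace hDR`.

## Proof (assembly of `AlmostEtale.exists_forall_eq_sub_of_cocycle_of_trace`)

(1) `V = W₀ ⊗ K̄_v` is `w`-integral and elliptic; `T_g = Φ_C ∘ g ∘ Φ_C⁻¹` acts on coordinates
through `g` for every `g` FIXING `C` (`KernelH1.transport_smul_of_eq_some`), so it preserves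
`E₁ = FormalGroupChart.kernel w V = Ŵ₀(𝔪̄)` with `z(T_g P) = g (z P)`. (2) `φ` vanishes on
`U = G ∩ Gal(K̄_v/M₁)` for a finite normal `M₁ ⊇` (a Krull neighbourhood field, the entries of `C`,
the coordinates of the finitely many values `Φ_C(φ g)`); `G/U` is finite. (3) `|z Φ_C(φ g)| ≤ ρ₀ < 1`;
the FACT at `(G, Gal(K̄_v/M₁), √ρ₀)` gives an integral `U`-fixed `x` with
`η = |Σ_{q ∈ G/U} q.out • x| > √ρ₀`, so `ρ₀ = η² θ`, `θ < 1`. (4) The layer `Kn = M₁ ⊔ K_v(G • x)` is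
finite over `K_v` (complete), `G`-stable and fixed by `U` (`GoodModelKernelH1Layer`);
`Rat = {P | T_u P = P ∀ u ∈ Gal(K̄_v/Kn)}` = `O` and the points with coordinates in `Kn`; Hensel
lifts `KernelH1.exists_mem_kernel_zCoord_eq_of_isAlgClosed` are rational by injectivity of `z` on
`E₁`. (5) The engine gives `P ∈ E₁ ∩ Rat` with `Φ_C(φ g) = T_g P − P`, i.e. `φ g = g • a − a`,
`a = Φ_C⁻¹ P`.

References: [CoatesGreenberg1996] §2 p. 143, Thm. 2.13, §3 Thm. 3.1 / Cor. 3.2;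
[IovitaZaharescu1999] Thm. 1.2; [GreenbergLNM1716] Greenberg pp. 83–84, Coates pp. 27, 36–37;
[Bondarko2007FormalGroupsSurvey] Thm. 9.2; [SilvermanAEC2009] VII.2.1–2.2; tree: the siblings
named above, `PeriodIndexSupportProofs` (pattern of the Milne I.3.8 discharge).
-/

noncomputable section

open scoped Classical NNReal

open WeierstrassCurve NumberField IsDedekindDomain Field
  Literature.NumberTheory.GaloisRepresentations Literature.NumberTheory.EllipticCurves
  Literature.NumberTheory.EllipticCurves.FormalGroupChart IsDedekindDomain.HeightOneSpectrum

universe u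

namespace Summit.BirchSwinnertonDyer.Rank1Residual.Additive.GoodModelLine.KernelH1

/-! ## The derivation -/

section Main

open CoatesGreenberg1996

variable {K : Type u} [Field K] [NumberField K] {v : HeightOneSpectrum (𝓞 K)}

set_option maxHeartbeats 1600000 in
/-- **The Coates–Greenberg vanishing for a good model, from the trace form of "deeply ramified"**
(all binders of the record `H1_goodModelKernel_trivial` explicit; the record itself is the next
theorem): for `E/K` elliptic over a number field, `p`, `κ` cyclotomic, `v ∋ p`, the spectral `w`, a
good model `W₀ = C • E ⊗ K̄_v`, a CLOSED `G ≤ (ker κ)_v` fixing `C`, every continuous crossed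
homomorphism `φ : G → E(K̄_v)` with `Φ_C(φ g) ∈ Ŵ₀(𝔪̄)` is `g ↦ g • a − a` with `Φ_C(a) ∈ Ŵ₀(𝔪̄)` —
[CoGr] Cor. 3.2 (`H¹(L, 𝓕(𝔪̄)) = 0`, `L = K̄_v^G` deeply ramified) by [CoGr]'s own mechanism
(Thm. 3.1 / Bondarko Thm. 9.2: `AlmostEtale.exists_forall_eq_sub_of_cocycle_of_trace`) from the trace
form of §2 p. 143 / Thm. 2.13 (`hDR`). Proof: module docstring. NOT a discharge of Tate–Sen.
[cite: CoatesGreenberg1996, §3 Cor. 3.2 with Thm. 3.1 (mechanism) and §2 p. 143 / Thm. 2.13 (input), through GreenbergLNM1716 pp. 27, 36–37, 83–84 and IovitaZaharescu1999 Thm. 1.2]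
[cite: Bondarko2007FormalGroupsSurvey, §9.2 Thm. 9.2] -/
theorem exists_eq_smul_sub_of_deeplyRamifiedTrace (hDR : deeplyRamified_cyclotomic_trace.{u})
    (W : WeierstrassCurve K) [W.IsElliptic] (p : ℕ) [Fact p.Prime] (κ : ZpExtension K p)
    (hκ : κ.IsCyclotomic) (hpv : ((p : ℕ) : 𝓞 K) ∈ v.asIdeal) (w : Valuation (AlgebraicClosure (v.adicCompletion K)) ℝ≥0)
    (hw : ∀ x, (w x : ℝ) = spectralNorm (v.adicCompletion K) (AlgebraicClosure (v.adicCompletion K)) x) (C : VariableChange (AlgebraicClosure (v.adicCompletion K)))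
    (W₀ : WeierstrassCurve w.integer)
    (hW₀ : C • (W.baseChange (v.adicCompletion K)).baseChange (AlgebraicClosure (v.adicCompletion K)) = W₀.baseChange (AlgebraicClosure (v.adicCompletion K))) (hΔ : IsUnit W₀.Δ)
    (G : Subgroup (absoluteGaloisGroup (v.adicCompletion K))) (hGc : IsClosed (G : Set (absoluteGaloisGroup (v.adicCompletion K)))) (hGκ : G ≤ localSubgroup κ.kerSubgroup (v.adicCompletion K))
    (hGC : ∀ σ ∈ G, C.map ((absoluteGaloisGroup.toAlgEquiv (v.adicCompletion K) σ : (AlgebraicClosure (v.adicCompletion K)) ≃ₐ[(v.adicCompletion K)] (AlgebraicClosure (v.adicCompletion K))) : (AlgebraicClosure (v.adicCompletion K)) →+* (AlgebraicClosure (v.adicCompletion K))) = C)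
    (φ : contOneCocycles (discreteTopRep G (localPoints W (v.adicCompletion K))))
    (hφ : ∀ g, Affine.Point.congrEquiv hW₀ (VariableChange.pointEquiv _ C
      (Affine.Point.congrEquiv (baseChange_baseChange_adicCompletion W v).symm (φ.1 g))) ∈
        kernelOfReduction W₀ (Valuation.integer.integers w)) :
    ∃ a : localPoints W (v.adicCompletion K), Affine.Point.congrEquiv hW₀ (VariableChange.pointEquiv _ C
        (Affine.Point.congrEquiv (baseChange_baseChange_adicCompletion W v).symm a)) ∈
          kernelOfReduction W₀ (Valuation.integer.integers w) ∧
      ∀ g : G, φ.1 g = g • a - a := by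
  -- §A notation and basic structure
  haveI hGal := isGalois_algebraicClosure_adicCompletion (v := v)
  haveI : CharZero (v.adicCompletion K) := charZero_of_injective_algebraMap (algebraMap K (v.adicCompletion K)).injective
  haveI hVint : (W₀.baseChange (AlgebraicClosure (v.adicCompletion K))).IsIntegral w.integer := ⟨⟨W₀, rfl⟩⟩
  haveI hVell : (W₀.baseChange (AlgebraicClosure (v.adicCompletion K))).IsElliptic := by
    rw [isElliptic_iff, baseChange, map_Δ]
    exact hΔ.map _
  have hvw : w.Integers w.integer := Valuation.integer.integers w
  -- the transport `Φ` and the transported action `T`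
  set Φ : localPoints W (v.adicCompletion K) ≃+ (W₀.baseChange (AlgebraicClosure (v.adicCompletion K))).toAffine.Point :=
    ((Affine.Point.congrEquiv (baseChange_baseChange_adicCompletion W v).symm).trans
      (VariableChange.pointEquiv _ C)).trans (Affine.Point.congrEquiv hW₀) with hΦdef
  have hΦ : ∀ P, Φ P = Affine.Point.congrEquiv hW₀ (VariableChange.pointEquiv _ C
      (Affine.Point.congrEquiv (baseChange_baseChange_adicCompletion W v).symm P)) := fun _ ↦ rfl
  set T : (absoluteGaloisGroup (v.adicCompletion K)) → (W₀.baseChange (AlgebraicClosure (v.adicCompletion K))).toAffine.Point →+ (W₀.baseChange (AlgebraicClosure (v.adicCompletion K))).toAffine.Point :=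
    fun g ↦ Φ.toAddMonoidHom.comp
      ((DistribSMul.toAddMonoidHom (localPoints W (v.adicCompletion K)) g).comp Φ.symm.toAddMonoidHom) with hTdef
  have hT : ∀ g P, T g P = Φ (g • Φ.symm P) := fun _ _ ↦ rfl
  set σ : (absoluteGaloisGroup (v.adicCompletion K)) → ((AlgebraicClosure (v.adicCompletion K)) ≃+* (AlgebraicClosure (v.adicCompletion K))) := fun g ↦ ((absoluteGaloisGroup.toAlgEquiv (v.adicCompletion K) g : (AlgebraicClosure (v.adicCompletion K)) ≃ₐ[(v.adicCompletion K)] (AlgebraicClosure (v.adicCompletion K))).toRingEquiv) with hσdef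
  have hσ : ∀ g z, σ g z = g • z := fun _ _ ↦ rfl
  have hσw : ∀ g z, w (σ g z) = w z := fun g z ↦ spectralValuation_smul hw g z
  -- `T` on coordinates, for `g` fixing `C`
  have hTsome : ∀ g : (absoluteGaloisGroup (v.adicCompletion K)), C.map ((absoluteGaloisGroup.toAlgEquiv (v.adicCompletion K) g : (AlgebraicClosure (v.adicCompletion K)) ≃ₐ[(v.adicCompletion K)] (AlgebraicClosure (v.adicCompletion K))) : (AlgebraicClosure (v.adicCompletion K)) →+* (AlgebraicClosure (v.adicCompletion K))) = C →
      ∀ {x y : (AlgebraicClosure (v.adicCompletion K))} {h : (W₀.baseChange (AlgebraicClosure (v.adicCompletion K))).toAffine.Nonsingular x y},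
      ∃ h', T g (.some x y h) = .some (σ g x) (σ g y) h' := by
    intro g hgC x y h
    have hP : Affine.Point.congrEquiv hW₀ (VariableChange.pointEquiv _ C
        (Affine.Point.congrEquiv (baseChange_baseChange_adicCompletion W v).symm
          (Φ.symm (.some x y h)))) = .some x y h := by
      rw [← hΦ, AddEquiv.apply_symm_apply]
    obtain ⟨h', e⟩ := transport_smul_of_eq_some W v C hW₀ g hgC (Φ.symm (.some x y h)) hP
    exact ⟨h', by rw [hT, hΦ, e]; rfl⟩
  have hTC_ker : ∀ g, C.map ((absoluteGaloisGroup.toAlgEquiv (v.adicCompletion K) g : (AlgebraicClosure (v.adicCompletion K)) ≃ₐ[(v.adicCompletion K)] (AlgebraicClosure (v.adicCompletion K))) : (AlgebraicClosure (v.adicCompletion K)) →+* (AlgebraicClosure (v.adicCompletion K))) = C →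
      ∀ P, P ∈ kernel w (W₀.baseChange (AlgebraicClosure (v.adicCompletion K))) →
        T g P ∈ kernel w (W₀.baseChange (AlgebraicClosure (v.adicCompletion K))) ∧ (T g P).zCoord = σ g P.zCoord := by
    intro g hgC P hPK
    rcases P with _ | ⟨x, y, h⟩
    · rw [← WeierstrassCurve.Affine.Point.zero_def, map_zero, WeierstrassCurve.Affine.Point.zCoord_zero,
        map_zero]
      exact ⟨(kernel w _).zero_mem, rfl⟩
    · obtain ⟨h', e⟩ := hTsome g hgC (x := x) (y := y) (h := h)
      rw [e, WeierstrassCurve.Affine.Point.zCoord_some, WeierstrassCurve.Affine.Point.zCoord_some,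
        some_mem_kernel_iff, hσw, map_div₀, map_neg]
      exact ⟨(some_mem_kernel_iff h).mp hPK, rfl⟩
  have hGC' : ∀ g : G, C.map ((absoluteGaloisGroup.toAlgEquiv (v.adicCompletion K) (g : (absoluteGaloisGroup (v.adicCompletion K))) : (AlgebraicClosure (v.adicCompletion K)) ≃ₐ[(v.adicCompletion K)] (AlgebraicClosure (v.adicCompletion K))) : (AlgebraicClosure (v.adicCompletion K)) →+* (AlgebraicClosure (v.adicCompletion K))) = C := fun g ↦ hGC g g.2
  have hTmul : ∀ g h P, T (g * h) P = T g (T h P) := by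
    intro g h P
    rw [hT, hT, hT, AddEquiv.symm_apply_apply, mul_smul]
  -- §B the transported crossed homomorphism
  set c : G → (W₀.baseChange (AlgebraicClosure (v.adicCompletion K))).toAffine.Point := fun g ↦ Φ (φ.1 g) with hcdef
  have hc_apply : ∀ g, c g = Φ (φ.1 g) := fun _ ↦ rfl
  have hcK : ∀ g, c g ∈ kernel w (W₀.baseChange (AlgebraicClosure (v.adicCompletion K))) := by
    intro g
    rw [hc_apply, mem_kernel_iff_reducesToZero W₀, ← mem_kernelOfReduction_iff hvw, hΦ]
    exact hφ g
  have hcoc : ∀ g h : G, c (g * h) = c g + T (g : (absoluteGaloisGroup (v.adicCompletion K))) (c h) := by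
    intro g h
    rw [hc_apply, hc_apply, hc_apply, hT, AddEquiv.symm_apply_apply, φ.2 g h, map_add,
      discreteTopRep_ρ_apply]
    rfl
  -- §C the open zero set and the finite normal layer `M₁`
  obtain ⟨L₀, hL₀fin, hL₀normal, hL₀sub⟩ := exists_normal_fixingSubgroup_subset G
    ((isOpen_discrete ({0} : Set (localPoints W (v.adicCompletion K)))).preimage φ.1.continuous)
    (show (1 : G) ∈ φ.1 ⁻¹' {0} from contOneCocycles.apply_one φ)
  haveI := hL₀fin
  haveI := hL₀normal
  -- the finite set of coordinates: values of `c`, coefficients of `V`, entries of `C`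
  haveI : CompactSpace G := isCompact_iff_compactSpace.mp hGc.isCompact
  have hfin_range : (Set.range φ.1).Finite := (isCompact_range φ.1.continuous).finite_of_discrete
  set S₀ : Set (AlgebraicClosure (v.adicCompletion K)) :=
    {z | ∃ P ∈ Set.range c, ∃ x y, ∃ h : (W₀.baseChange (AlgebraicClosure (v.adicCompletion K))).toAffine.Nonsingular x y,
        P = .some x y h ∧ (z = x ∨ z = y)} ∪ ({(C.u : (AlgebraicClosure (v.adicCompletion K))), C.r, C.s, C.t} : Set (AlgebraicClosure (v.adicCompletion K))) with hS₀def
  have hfin_c : (Set.range c).Finite :=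
    Set.Finite.subset (hfin_range.image Φ) (by rintro _ ⟨g, rfl⟩; exact ⟨φ.1 g, ⟨g, rfl⟩, rfl⟩)
  have hS₀fin : S₀.Finite := Set.Finite.union (finite_coords hfin_c) (Set.toFinite _)
  haveI : Finite S₀ := hS₀fin.to_subtype
  haveI hS₀fd : FiniteDimensional (v.adicCompletion K) (IntermediateField.adjoin (v.adicCompletion K) S₀) :=
    IntermediateField.finiteDimensional_adjoin fun z _ ↦
      (Algebra.IsAlgebraic.isAlgebraic (R := (v.adicCompletion K)) z).isIntegral
  set M₀ : IntermediateField (v.adicCompletion K) (AlgebraicClosure (v.adicCompletion K)) := L₀ ⊔ IntermediateField.adjoin (v.adicCompletion K) S₀ with hM₀def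
  haveI : FiniteDimensional (v.adicCompletion K) M₀ := IntermediateField.finiteDimensional_sup _ _
  set M₁ : IntermediateField (v.adicCompletion K) (AlgebraicClosure (v.adicCompletion K)) := IntermediateField.normalClosure (v.adicCompletion K) M₀ (AlgebraicClosure (v.adicCompletion K)) with hM₁def
  haveI hM₁fd : FiniteDimensional (v.adicCompletion K) M₁ := by rw [hM₁def]; infer_instance
  haveI hM₁n : Normal (v.adicCompletion K) M₁ := by rw [hM₁def]; infer_instance
  have hM₀M₁ : M₀ ≤ M₁ := by rw [hM₁def]; exact IntermediateField.le_normalClosure M₀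
  have hL₀M₁ : L₀ ≤ M₁ := by
    refine le_trans ?_ hM₀M₁
    rw [hM₀def]; exact le_sup_left
  have hS₀M₁ : S₀ ⊆ (M₁ : Set (AlgebraicClosure (v.adicCompletion K))) := by
    refine (IntermediateField.subset_adjoin (v.adicCompletion K) S₀).trans ?_
    have h : IntermediateField.adjoin (v.adicCompletion K) S₀ ≤ M₁ := le_trans (by rw [hM₀def]; exact le_sup_right) hM₀M₁
    exact h
  -- the open normal subgroup `O = Gal(K̄_v/M₁)` and `U = G ∩ O`
  set O : Subgroup (absoluteGaloisGroup (v.adicCompletion K)) := M₁.fixingSubgroup.comap (absoluteGaloisGroup.toAlgEquiv (v.adicCompletion K)).toMonoidHom with hOdef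
  have hO_mem : ∀ τ, τ ∈ O ↔ absoluteGaloisGroup.toAlgEquiv (v.adicCompletion K) τ ∈ M₁.fixingSubgroup := fun _ ↦ Subgroup.mem_comap
  have hOopen : IsOpen (O : Set (absoluteGaloisGroup (v.adicCompletion K))) := M₁.fixingSubgroup_isOpen
  set U : Subgroup G := O.subgroupOf G with hUdef
  haveI : Finite (G ⧸ U) := finite_quotient_subgroupOf_fixingSubgroup M₁ G
  letI : Fintype (G ⧸ U) := Fintype.ofFinite _
  have hUt : ∀ u : G, u ∈ U → φ.1 u = 0 := fun u hu ↦ hL₀sub u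
    (IntermediateField.fixingSubgroup_le hL₀M₁ ((hO_mem _).mp (Subgroup.mem_subgroupOf.mp hu)))
  have hcU : ∀ u ∈ U, c u = 0 := fun u hu ↦ by rw [hc_apply, hUt u hu, map_zero]
  -- §D the bound `ρ₀` and the FACT
  set ρ₀ : ℝ≥0 := hfin_range.toFinset.sup fun P ↦ w (Φ P).zCoord with hρ₀def
  have hρ₀lt : ρ₀ < 1 := by
    rw [hρ₀def, Finset.sup_lt_iff (bot_lt_iff_ne_bot.mpr one_ne_zero)]
    intro P hP
    obtain ⟨g, rfl⟩ := hfin_range.mem_toFinset.mp hP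
    exact val_zCoord_lt_one (hcK g)
  have hcρ₀ : ∀ g, w (c g).zCoord ≤ ρ₀ :=
    fun g ↦ Finset.le_sup (f := fun P ↦ w (Φ P).zCoord) (hfin_range.mem_toFinset.mpr ⟨g, rfl⟩)
  have hsqrt : NNReal.sqrt ρ₀ < 1 := by rw [← NNReal.sqrt_one]; exact NNReal.sqrt_lt_sqrt.mpr hρ₀lt
  obtain ⟨x, hx1, hxU, hxtr⟩ := hDR K p κ hκ v hpv w hw G hGc hGκ O hOopen (NNReal.sqrt ρ₀) hsqrt
  -- the trace and the contraction rate
  have hsum_eq : (∑ q : G ⧸ U, σ ((q.out : G) : (absoluteGaloisGroup (v.adicCompletion K))) x) =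
      ∑ q : G ⧸ O.subgroupOf G, ((q.out : G) : (absoluteGaloisGroup (v.adicCompletion K))) • x := rfl
  have hηpos : 0 < w (∑ q : G ⧸ U, σ ((q.out : G) : (absoluteGaloisGroup (v.adicCompletion K))) x) := lt_of_le_of_lt zero_le (hsum_eq ▸ hxtr)
  have hη2 : ρ₀ < w (∑ q : G ⧸ U, σ ((q.out : G) : (absoluteGaloisGroup (v.adicCompletion K))) x) ^ 2 := by
    rw [hsum_eq]
    exact NNReal.sqrt_lt_sqrt.mp (by rw [NNReal.sqrt_sq]; exact hxtr :
      NNReal.sqrt ρ₀ < NNReal.sqrt (w (∑ q : G ⧸ O.subgroupOf G, ((q.out : G) : (absoluteGaloisGroup (v.adicCompletion K))) • x) ^ 2))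
  -- §E the finite `G`-stable layer `Kn ∋ x` fixed by `U`
  set orb : Set (AlgebraicClosure (v.adicCompletion K)) := Set.range fun q : G ⧸ U ↦ ((q.out : G) : (absoluteGaloisGroup (v.adicCompletion K))) • x with horbdef
  haveI : Finite orb := Set.finite_range _ |>.to_subtype
  haveI : FiniteDimensional (v.adicCompletion K) (IntermediateField.adjoin (v.adicCompletion K) orb) :=
    IntermediateField.finiteDimensional_adjoin fun z _ ↦
      (Algebra.IsAlgebraic.isAlgebraic (R := (v.adicCompletion K)) z).isIntegral
  set Kn : IntermediateField (v.adicCompletion K) (AlgebraicClosure (v.adicCompletion K)) := M₁ ⊔ IntermediateField.adjoin (v.adicCompletion K) orb with hKndef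
  haveI hKnfd : FiniteDimensional (v.adicCompletion K) Kn := IntermediateField.finiteDimensional_sup _ _
  have hM₁Kn : M₁ ≤ Kn := le_sup_left
  -- `x ∈ orb`; `G`-stability of `Kn`; `U` fixes `Kn` pointwise (`GoodModelKernelH1Layer`)
  have hxorb : x ∈ orb := by
    have h := smul_mem_range_out_smul M₁ G x hxU (1 : G)
    rw [Subgroup.coe_one, one_smul] at h
    exact h
  have hxKn : x ∈ Kn := (le_sup_right : _ ≤ Kn) (IntermediateField.subset_adjoin _ _ hxorb)
  have hKnG : ∀ g : G, ∀ z ∈ Kn, (g : (absoluteGaloisGroup (v.adicCompletion K))) • z ∈ Kn :=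
    fun g z hz ↦ smul_mem_orbitLayer M₁ G x hxU g hz
  have hUKn : ∀ u : G, u ∈ U → ∀ z ∈ Kn, (u : (absoluteGaloisGroup (v.adicCompletion K))) • z = z :=
    fun u hu z hz ↦ smul_eq_self_of_mem_orbitLayer M₁ G x hxU ⟨Subgroup.mem_subgroupOf.mp hu, u.2⟩ hz
  -- `Gal(K̄_v/Kn)` fixes `C` (entries of `C` lie in `M₁ ≤ Kn`)
  have hKnC : ∀ τ : (absoluteGaloisGroup (v.adicCompletion K)), absoluteGaloisGroup.toAlgEquiv (v.adicCompletion K) τ ∈ Kn.fixingSubgroup → C.map ((absoluteGaloisGroup.toAlgEquiv (v.adicCompletion K) τ : (AlgebraicClosure (v.adicCompletion K)) ≃ₐ[(v.adicCompletion K)] (AlgebraicClosure (v.adicCompletion K))) : (AlgebraicClosure (v.adicCompletion K)) →+* (AlgebraicClosure (v.adicCompletion K))) = C := by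
    intro τ hτ
    rw [IntermediateField.mem_fixingSubgroup_iff] at hτ
    have hfix : ∀ z ∈ S₀, (absoluteGaloisGroup.toAlgEquiv (v.adicCompletion K) τ) z = z := fun z hz ↦ hτ z (hM₁Kn (hS₀M₁ hz))
    have hu : (absoluteGaloisGroup.toAlgEquiv (v.adicCompletion K) τ) (C.u : (AlgebraicClosure (v.adicCompletion K))) = C.u := hfix _ (Or.inr (by simp))
    have hr : (absoluteGaloisGroup.toAlgEquiv (v.adicCompletion K) τ) C.r = C.r := hfix _ (Or.inr (by simp))
    have hs : (absoluteGaloisGroup.toAlgEquiv (v.adicCompletion K) τ) C.s = C.s := hfix _ (Or.inr (by simp))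
    have ht' : (absoluteGaloisGroup.toAlgEquiv (v.adicCompletion K) τ) C.t = C.t := hfix _ (Or.inr (by simp))
    exact variableChange_map_eq_of_apply_eq C _ hu hr hs ht'
  -- §F the subgroup `Rat` of points fixed by `Gal(K̄_v/Kn)` and its description by coordinates
  set Rat : AddSubgroup (W₀.baseChange (AlgebraicClosure (v.adicCompletion K))).toAffine.Point :=
    { carrier := {P | ∀ τ : (absoluteGaloisGroup (v.adicCompletion K)), absoluteGaloisGroup.toAlgEquiv (v.adicCompletion K) τ ∈ Kn.fixingSubgroup → T τ P = P}
      add_mem' := fun {P Q} hP hQ τ hτ ↦ by rw [map_add, hP τ hτ, hQ τ hτ]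
      zero_mem' := fun τ _ ↦ map_zero _
      neg_mem' := fun {P} hP τ hτ ↦ by rw [map_neg, hP τ hτ] } with hRatdef
  have hRat_mem : ∀ P, P ∈ Rat ↔ ∀ τ : (absoluteGaloisGroup (v.adicCompletion K)), absoluteGaloisGroup.toAlgEquiv (v.adicCompletion K) τ ∈ Kn.fixingSubgroup → T τ P = P := fun _ ↦ Iff.rfl
  have hKn_mem : ∀ z : (AlgebraicClosure (v.adicCompletion K)), z ∈ Kn ↔ ∀ τ : (absoluteGaloisGroup (v.adicCompletion K)), absoluteGaloisGroup.toAlgEquiv (v.adicCompletion K) τ ∈ Kn.fixingSubgroup → σ τ z = z :=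
    fun z ↦ mem_iff_forall_smul_eq Kn z
  have hRat_coords : ∀ {X Y : (AlgebraicClosure (v.adicCompletion K))} {h : (W₀.baseChange (AlgebraicClosure (v.adicCompletion K))).toAffine.Nonsingular X Y},
      (.some X Y h) ∈ Rat ↔ X ∈ Kn ∧ Y ∈ Kn := by
    intro X Y h
    rw [hRat_mem, hKn_mem, hKn_mem]
    constructor
    · intro hP
      refine ⟨fun τ hτ ↦ ?_, fun τ hτ ↦ ?_⟩ <;>
      · obtain ⟨h', e⟩ := hTsome τ (hKnC τ hτ) (x := X) (y := Y) (h := h)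
        have := (e.symm.trans (hP τ hτ))
        simp only [WeierstrassCurve.Affine.Point.some.injEq] at this
        first | exact this.1 | exact this.2
    · rintro ⟨hX, hY⟩ τ hτ
      obtain ⟨h', e⟩ := hTsome τ (hKnC τ hτ) (x := X) (y := Y) (h := h)
      rw [e]
      exact point_some_eq_some (hX τ hτ) (hY τ hτ)
  -- §G the remaining inputs of the engine
  have hRatU' : ∀ u : G, u ∈ U → absoluteGaloisGroup.toAlgEquiv (v.adicCompletion K) (u : (absoluteGaloisGroup (v.adicCompletion K))) ∈ Kn.fixingSubgroup := by
    intro u hu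
    rw [IntermediateField.mem_fixingSubgroup_iff]
    exact hUKn u hu
  have hRatT : ∀ g : G, ∀ P ∈ Rat, T (g : (absoluteGaloisGroup (v.adicCompletion K))) P ∈ Rat := by
    intro g P hP
    rcases P with _ | ⟨X, Y, h⟩
    · rw [← WeierstrassCurve.Affine.Point.zero_def, map_zero]; exact Rat.zero_mem
    · obtain ⟨hX, hY⟩ := hRat_coords.mp hP
      obtain ⟨h', e⟩ := hTsome _ (hGC' g) (x := X) (y := Y) (h := h)
      rw [e, hRat_coords, hσ, hσ]
      exact ⟨hKnG g X hX, hKnG g Y hY⟩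
  have hRatz : ∀ P ∈ Rat, P ∈ kernel w (W₀.baseChange (AlgebraicClosure (v.adicCompletion K))) → P.zCoord ∈ Kn.toSubfield := by
    intro P hP _
    rcases P with _ | ⟨X, Y, h⟩
    · rw [← WeierstrassCurve.Affine.Point.zero_def, WeierstrassCurve.Affine.Point.zCoord_zero]
      exact Kn.toSubfield.zero_mem
    · obtain ⟨hX, hY⟩ := hRat_coords.mp hP
      rw [WeierstrassCurve.Affine.Point.zCoord_some]
      exact Kn.toSubfield.div_mem (Kn.toSubfield.neg_mem hX) hY
  have hlift : ∀ z ∈ Kn.toSubfield, w z < 1 →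
      ∃ P ∈ kernel w (W₀.baseChange (AlgebraicClosure (v.adicCompletion K))), P ∈ Rat ∧ P.zCoord = z := by
    intro z hz hz1
    obtain ⟨P, hPK, hPz⟩ :=
      exists_mem_kernel_zCoord_eq_of_isAlgClosed (V := W₀.baseChange (AlgebraicClosure (v.adicCompletion K))) (w := w) hz1
    refine ⟨P, hPK, (hRat_mem P).mpr fun τ hτ ↦ ?_, hPz⟩
    obtain ⟨hTK, hTz⟩ := hTC_ker τ (hKnC τ hτ) P hPK
    refine eq_of_mem_kernel_of_zCoord_eq hTK hPK ?_
    rw [hTz, hPz]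
    rw [IntermediateField.mem_fixingSubgroup_iff] at hτ
    exact hτ z hz
  have hcomplete : ∀ θ : ℝ≥0, θ < 1 → ∀ a : ℕ → (AlgebraicClosure (v.adicCompletion K)),
      (∀ r, a r ∈ Kn.toSubfield) → (∀ r, w (a (r + 1) - a r) ≤ θ ^ (r + 1)) →
      ∃ z ∈ Kn.toSubfield, ∀ r, w (z - a r) ≤ θ ^ (r + 1) := by
    intro θ hθ a ha hcau
    obtain ⟨y, hy⟩ := exists_limit_of_finiteDimensional hw Kn hθ (fun r ↦ ⟨a r, ha r⟩) hcau
    exact ⟨y, y.2, hy⟩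
  have hcR : ∀ g, c g ∈ Rat := by
    intro g
    rcases hQ : c g with _ | ⟨X, Y, h⟩
    · exact Rat.zero_mem
    · rw [hRat_coords]
      have hXS : X ∈ S₀ := Or.inl ⟨c g, ⟨g, rfl⟩, X, Y, h, hQ, Or.inl rfl⟩
      have hYS : Y ∈ S₀ := Or.inl ⟨c g, ⟨g, rfl⟩, X, Y, h, hQ, Or.inr rfl⟩
      exact ⟨hM₁Kn (hS₀M₁ hXS), hM₁Kn (hS₀M₁ hYS)⟩
  obtain ⟨θ, hθ1, hρ₀θ⟩ : ∃ θ : ℝ≥0, θ < 1 ∧ ρ₀ = w (∑ q : G ⧸ U, σ ((q.out : G) : (absoluteGaloisGroup (v.adicCompletion K))) x) ^ 2 * θ := by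
    have hη2pos : 0 < w (∑ q : G ⧸ U, σ ((q.out : G) : (absoluteGaloisGroup (v.adicCompletion K))) x) ^ 2 := pow_pos hηpos 2
    exact ⟨ρ₀ / _ ^ 2, by rw [div_lt_one hη2pos]; exact hη2, by rw [mul_div_cancel₀ _ hη2pos.ne']⟩
  have hcz : ∀ g, w (c g).zCoord ≤ w (∑ q : G ⧸ U, σ ((q.out : G) : (absoluteGaloisGroup (v.adicCompletion K))) x) ^ 2 * θ :=
    fun g ↦ hρ₀θ ▸ hcρ₀ g
  -- §H the engine
  obtain ⟨P, hPK, -, hP⟩ := AlmostEtale.exists_forall_eq_sub_of_cocycle_of_trace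
    (V := W₀.baseChange (AlgebraicClosure (v.adicCompletion K))) (w := w) (U := U) (σ := fun g : G ↦ σ (g : (absoluteGaloisGroup (v.adicCompletion K))))
    (T := fun g : G ↦ T (g : (absoluteGaloisGroup (v.adicCompletion K)))) (S := Kn.toSubfield) (Rat := Rat) (x := x)
    (fun g h z ↦ by rw [Subgroup.coe_mul, hσ, hσ, hσ, mul_smul]) (fun g z ↦ hσw _ z)
    (fun g h Q ↦ by rw [Subgroup.coe_mul]; exact hTmul _ _ Q)
    (fun g Q hQ ↦ (hTC_ker _ (hGC' g) Q hQ).1) (fun g Q hQ ↦ (hTC_ker _ (hGC' g) Q hQ).2)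
    (fun g s hs ↦ by rw [hσ]; exact hKnG g s hs) (fun u hu s hs ↦ by rw [hσ]; exact hUKn u hu s hs)
    hRatT (fun u hu Q hQ ↦ hQ _ (hRatU' u hu)) hRatz hlift hcomplete hx1 hxKn hηpos hθ1
    hcoc hcK hcR hcU hcz
  -- §I conclusion
  refine ⟨Φ.symm P, ?_, fun g ↦ ?_⟩
  · rw [← hΦ, AddEquiv.apply_symm_apply, mem_kernelOfReduction_iff, ← mem_kernel_iff_reducesToZero W₀]
    exact hPK
  · apply Φ.injective
    rw [map_sub, ← hc_apply, hP g, hT, AddEquiv.apply_symm_apply]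
    rfl

/-- **The record `CoatesGreenberg1996.H1_goodModelKernel_trivial` (A254: [CoGr] Cor. 3.2 in good-model
cocycle form; `hCG` of the Route-2 e346 ENDs, of S2 / A239 / A111 / (I2), of T-CG-SS) DERIVED from
the trace form of "deeply ramified"** (`exists_eq_smul_sub_of_deeplyRamifiedTrace` with the record's
binders). Registry: A254 DERIVED modulo `deeplyRamified_cyclotomic_trace`; NOT a discharge of
Tate–Sen / [CoGr] §2. Consumers may switch `hCG ↦ H1_goodModelKernel_trivial_of_deeplyRamifiedTrace hDR`.
[cite: CoatesGreenberg1996, §3 Cor. 3.2 (through GreenbergLNM1716 pp. 36–37 (74), 83–84) ⇐ §2 p. 143 / Thm. 2.13 (through IovitaZaharescu1999 Thm. 1.2)] -/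
theorem _root_.Literature.NumberTheory.EllipticCurves.CoatesGreenberg1996.H1_goodModelKernel_trivial_of_deeplyRamifiedTrace
    (hDR : deeplyRamified_cyclotomic_trace.{u}) : H1_goodModelKernel_trivial.{u} :=
  fun _K _ _ W _ p _ κ hκ _v hpv w hw C W₀ hW₀ hΔ G hGc hGκ hGC φ hφ ↦
    exists_eq_smul_sub_of_deeplyRamifiedTrace hDR W p κ hκ hpv w hw C W₀ hW₀ hΔ G hGc hGκ hGC φ hφ

/-- **(I2) from the deeply-ramified trace fact**: the supersingular-lane record
`WeierstrassCurve.CoatesGreenberg1996_H1_formalGroup_trivial` (`H¹(K_∞K_v, 𝓕(𝔪̄)) = 0` for the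
minimal model of a curve with good reduction at `v ∣ p`, Greenberg LNM 1716 p. 83, input `h2` of
Thm. 1.7) — already DERIVED from A254 by `…_of_goodModelKernel` — is now derived from
`deeplyRamified_cyclotomic_trace`. [cite: GreenbergLNM1716, §2 p. 83 ("special case of Corollary 3.2 in [CoGr]")] -/
theorem _root_.WeierstrassCurve.CoatesGreenberg1996_H1_formalGroup_trivial_of_deeplyRamifiedTrace
    (hDR : deeplyRamified_cyclotomic_trace.{u}) : CoatesGreenberg1996_H1_formalGroup_trivial.{u} :=
  CoatesGreenberg1996_H1_formalGroup_trivial_of_goodModelKernel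
    (CoatesGreenberg1996.H1_goodModelKernel_trivial_of_deeplyRamifiedTrace hDR)

end Main

end Summit.BirchSwinnertonDyer.Rank1Residual.Additive.GoodModelLine.KernelH1

end
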